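import Literature.Geometry.Symplectic.LegendrianRealisation
import Literature.Topology.FourManifolds.HandleAttachingMaps
import Literature.Topology.FourManifolds.SmoothOrientation
import HarnessLib

/-!
# Framed attaching circles of 2-handles: homotopies of framings, isotopy invariance of the
# attachment, and realisation of a framed knot by an attaching map (named facts)

Topic `Literature/Geometry/Symplectic` (the statements are topological, but the framing
vocabulary they are phrased in — `IsKnotFraming`, `IsBoundaryKnot`, `KnotIsotopyInBoundary`,
`LinkIsotopyInBoundary`, `IsFramingAlong` — lives in `SteinBoundaryContact.lean` and
`LegendrianRealisation.lean`).  Two classical facts about attaching 4-dimensional 2-handles along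
attaching maps `h̄ : T → W` (`Topology/FourManifolds/HandleAttachingMaps.lean`,
`HandleAttachingMap 3 2 W`, with attaching circle `h.attachingCircle : S¹ → ∂W` and handle framing
`h.attachingFraming`) that the proof of Akbulut–Matveyev (1998), Thm. 3 uses tacitly when it
replaces attaching circles by Legendrian (Legendrian realisation of links, Gompf 1998, §1 — part
of the proof obligation of `AkbulutMatveyev1998_thm3`, see the module docstring of
`LegendrianRealisation.lean`) and stabilised (`Gompf1998_addLeftTwists`) isotopic copies:
*"Since every curve in contact manifold is isotopic to a Legendrian curve via smooth `C⁰`-small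
isotopy, we can assume that 2-handles in handlebodies of `Xᵢ` are attached to Legendrian knots
in `∂Yᵢ`"* (§4) and *"by `C⁰`-small smooth isotopy of
`K` we can decrease Thurston–Bennequin invariant … Therefore, by a theorem of Eliashberg,
manifold `Z ∪ h` possesses PC structure"* (§3) — i.e. the attached manifold only depends on the
framed isotopy class of the attaching circles, and every framed knot is an attaching circle:

* `FramingHomotopic K ν ν'` (definition) — the framings `ν`, `ν'` of the knot `K` in `∂W` are
  homotopic through framings (a framing family along the constant isotopy, `IsFramingAlong`);
* `HandleAttachingMap.isMultiAttachment_of_linkIsotopyInBoundary` (**ISO**, named fact) — if the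
  attaching circles of the families `h`, `h'` of attaching maps are isotopic through links in
  `∂W` (`LinkIsotopyInBoundary`), the handle framings of `h` being carried along the isotopy
  (`IsFramingAlong`) to framings homotopic to the handle framings of `h'`, then every `P` which
  is `W` with 2-handles attached along `h` is also `W` with 2-handles attached along `h'`
  (`HandleAttachingMap.IsMultiAttachment`).  Kirby (1989), Ch. I §1 (handlebodies are determined
  by the attaching maps up to isotopy: *"the `h_t` move through Morse functions, which correspond
  to isotopy of the attaching maps `fᵢ`"*; Thm. 1.1); Kosinski (1993), VI §6 with VIII, proof
  of Lemma 1.2 (*"Since `Σ₂` is isotopic to `S`, `W₂` can be obtained by attaching a handle along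
  `S` instead"*): isotopy extension in `∂W` (Kosinski II 5.2) extended over a collar, uniqueness
  of tubular neighbourhoods (III 3.1), and uniqueness of the gluing (`IsOpenGluing.nonempty_diffeomorph`).
* `exists_handleAttachingMap_of_isKnotFraming` (**TUBE**, named fact, **discharged**:
  `exists_handleAttachingMap_of_isKnotFraming_holds`, `TwoHandleIsotopyProofs.lean`) — on a
  compact *orientable* `W`, every knot `K` in `∂W` with a framing `ν` is the attaching circle
  of an attaching map `h̄` with range inside any prescribed open neighbourhood of `K(S¹)` and
  whose handle framing is homotopic to `ν`: tubular neighbourhood of `K` in `∂W` (trivial normal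
  bundle: `∂W` is orientable; Kosinski III 3.1, IV 5) prolonged into `W` along a collar (Kosinski
  VI §6: "`h̄ : T → M` an extension of `h` and a tubular neighborhood of `h(S)` in `M`").
  Orientability cannot be dropped: on a non-orientable `∂W` a knot with non-orientable normal
  bundle still admits a nowhere-vanishing normal field (`IsKnotFraming`) but no attaching map.

Proved API: `FramingHomotopic.refl`, `FramingHomotopic.symm` (reverse the family),
`FramingHomotopic.isKnotFraming_left/right`, the one-handle form of ISO, and the unpacking of
TUBE.  TUBE is stated *in ISO's direction* (`FramingHomotopic K ν h.attachingFraming`: from the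
prescribed framing to the handle framing) and *locally* (the attaching map can be chosen with
range in any prescribed open neighbourhood of the knot, so that for a link the attaching maps of
the components can be taken with pairwise disjoint ranges, as ISO requires).  That the handle
framing of every attaching map is a knot framing (`IsKnotFraming`, needed to enter ISO's
`IsFramingAlong` at stage `0` and `Gompf1998_addLeftTwists`) is the theorem
`isKnotFraming_attachingFraming` of `AttachingFramingProofs.lean`; that the attaching circle is a
knot in `∂W` (`IsBoundaryKnot`: a smooth embedding with boundary values) is the theorem
`isBoundaryKnot_attachingCircle` of `AttachingCircleProofs.lean`.

## State of the proofs (review D-0026, 2026-08-15) and roadmap for ISO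

Mathlib has no handles, tubular neighbourhoods, collars or isotopy extension, but **the tree
has all of them, proved**; TUBE is discharged with them (`TwoHandleIsotopyProofs.lean`: the
boundary 3-manifold `Y = ∂W` of `BoundaryManifold.boundaryData 3 W` (`Cobordism.lean`), maps
into it `BoundaryManifold.contMDiff_codRestrict` (`RegularDomainMaps.lean`), the differential
`consZeroL` of `Y ↪ W` (`hasMFDerivAt_subtype_val_boundary`), tubes in `Y`
(`FramedCircleTube.lean`), the collar `BoundaryData.nonempty_collar_of_compactSpace`
(`CollarTheorem.lean`) and the attaching map `TubeAttachData.attachingMap` of a tube prolonged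
along a collar, `h̄ y = c (Φ (x_λ/|x_λ|, κ x_μ), δ (1 - ‖x‖²))` (`HandleAttachingMapOfTube.lean`)).
ISO was reviewed (D-0026: a decomposition child, triaged XL by its seat) and found correctly
cut and **provable inline, without new named facts**, along Kosinski's mechanism (VI §1 proof of
(1.1): dependence only on the germ at the sphere; VI §5: independence of the extension `h̄` =
uniqueness of collars; VI (7.2), proof: *"an isotopy of `∂M` … extended over `M`, using the
collar of `∂M`, in the usual way"*).  The formal half is proved:
`HandleAttachingMap.IsMultiAttachment.transport` (`HandleAttachingMapsTransport.lean`: transport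
along a diffeomorphism of `W`), `isMultiAttachment_reframe_iff` (`…Symmetry.lean`: reflections
of an `x_μ`-coordinate), `IsMultiAttachment.of_eqOn_near_sphere` (`…Locality.lean`: only the germ
of `h̄` at `S` matters; `…Inversion.lean`).  Remaining steps, each an assembly over proved tree
theorems (write `N_c Φ` for `TubeAttachData.attachingMap` of the tube `Φ` and the collar `c`):

1. *Adapted collars*: a collar `c` of `W` whose lines through the boundary tube of the `h i`
   are the depth lines of the `h i`, so that `h i = N_c Φᵢ` near `S` (`Φᵢ` the boundary tube of
   `h i` read in `Y`); built by the flow-out pipeline of `BoundaryFlowout.lean` /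
   `CollarTheoremGeneral.lean` (`FlowoutInput`, `CollarFlowData`) from a depth function and a
   field glued, near the cores, from `tubeDepth ∘ (h i)⁻¹` and `(h i)_* ∂_depth` (the
   normalisation `ξ(f) = 1` is affine); likewise `c'` for `h'`.  By locality,
   `IsMultiAttachment h P ↔ IsMultiAttachment (N_c Φ) P`.
2. *Ambient uniqueness of collars*: for two collars `c`, `c'` of the compact `W` a
   diffeomorphism `Γ` of `W` with `Γ (c (z, s)) = c' (z, s)` for small `s` — the germ form
   `CollarGerm.exists_extension` (`CollarGermExtension.lean`, over the closed `Y`) glued with the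
   identity as in `ComparisonFrame.Ext.glueDiffeomorph` (`GluingSmoothing.lean`); transport along
   `Γ` turns `N_c Φ'` into `N_{c'} Φ'` near `S`.
3. *Isotopy extension inside the closed 3-manifold `Y`*: the link isotopy, lifted to `Y` as one
   smooth isotopy of the compact boundaryless source `ι × S¹` (`ChartedSpace.of_discreteTopology`,
   `IsManifold.of_discreteTopology` on the finite `ι`), extends to an ambient isotopy `Ψ` of `Y`
   (`exists_ambientIsotopy_comp_eq`, `IsotopyExtension.lean`; with support,
   `IsotopyExtensionSupport.lean`); `AmbientIsotopy.toDiffeotopy` (`InverseFunctionTheorem.lean`)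
   and `BoundaryData.Collar.slideExtension` (`CollarExtension.lean`, `slideExtension_comp_incl`;
   the slide is the identity in the collar coordinate below height `1/4`) give a diffeomorphism
   `G` of `W` with `G ∘ N_c Φ = N_c (Ψ₁ ∘ Φ)` exactly (for `δ ≤ 1/4`), to which `transport`
   applies.
4. *Framings*: the carried framing `νt` and the pushed framing `dΨ_t ν₀` are framing families
   along the same isotopy from the same `ν₀`; pulling back by `Ψ_t` and pushing forward by `Ψ₁`
   shows `FramingHomotopic K₁ (dΨ₁ ν₀) (νt 1)`, whence, with the hypothesis of ISO, the fibre
   components of the framing of `Ψ₁ ∘ Φ` in the tube coordinates of `Φ'` form a loop of degree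
   `0` in `ℝ² ∖ 0` (winding numbers as in `TwistingHomotopyProofs.lean`; add
   `FramingHomotopic.trans`).
5. *Uniqueness of tubular neighbourhoods in `Y` up to a reflection* (the long pole; pattern of
   `LinkTubularUniqueness.lean`, with the stereographic chart of `S³` replaced by the coordinates
   of the tubes `Φ'ᵢ`, the components being pairwise apart): transition map `Φ'⁻¹ ∘ Φ`,
   linearisation `τ(θ, t w)/t`, polar decomposition of the fibre derivative, and the degree-`0`
   condition of step 4 yield a smooth isotopy of the compact source `ι × (S¹ × 𝔻²)` from
   `Φ' ∘ (id × A)` (`A = 1` or `diag (1, -1)`) to `Φ` near the zero section; it is ambient by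
   `SmoothIsotopy.exists_ambientIsotopy_comp_eq_holds` (`IsotopyExtensionCorners.lean`: any
   source model with corners, closed target), spread over the collar as in step 3, and the
   reflection `A` is a handle symmetry (`isMultiAttachment_reframe_iff`).
6. Assembly: `h ↝ N_c Φ ↝ N_c (Ψ₁ Φ) ↝ N_c (Φ' ∘ A) ↝ N_c Φ' ↝ N_{c'} Φ' ↝ h'` by locality,
   transport (steps 3, 5, 2) and symmetry.

No flow of vector fields tangent to `∂W` is needed (the tree's `FlowsBoundary.lean` only treats
fields vanishing near the boundary): every ambient move is made in the closed manifold `Y` and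
spread over a collar, or is a flow-free comparison of collars.

## References

* R. C. Kirby, *The Topology of 4-Manifolds*, LNM 1374 (1989), Ch. I §1, Thm. 1.1, §2. [Kirby1989]
* A. A. Kosinski, *Differential Manifolds* (1993), II (5.2) isotopy extension, III (3.1)
  uniqueness of tubular neighbourhoods, VI §6, VIII proof of (1.2). [Kosinski1993]
* S. Akbulut, R. Matveyev, IMRN 1998, §§3–4. [AkbulutMatveyev1998]
* R. E. Gompf, Ann. of Math. 148 (1998), §1 ("canonical framing … up to fiber homotopy").
  [Gompf1998]
-/

noncomputable section

open scoped Manifold ContDiff Topology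
open Set Function

namespace Literature.Geometry.Symplectic

open Literature.Topology.FourManifolds

/-- The model vector space `ℝ⁴` of the tangent spaces. [folklore] -/
local notation "E4" => EuclideanSpace ℝ (Fin 4)

/-- Local notation: `𝕊 n` is the unit sphere in `EuclideanSpace ℝ (Fin (n + 1))`. -/
local notation "𝕊 " n:arg => (Metric.sphere (0 : EuclideanSpace ℝ (Fin (n + 1))) 1)

/-! ### Homotopic framings of a fixed knot -/

section FramingHomotopy

variable {W : Type*} [TopologicalSpace W] [ChartedSpace (EuclideanHalfSpace 4) W]
  [IsManifold (𝓡∂ 4) ∞ W]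

/-- **The framings `ν`, `ν'` of the knot `K` in `∂W` are homotopic (through framings)**: `K` is a
knot in `∂W` and there is a framing family along the constant isotopy of `K` (`IsFramingAlong`:
every stage a framing, jointly continuous into the tangent bundle) from `ν` to `ν'` — framings
"up to fiber homotopy" (Gompf 1998, §1). [folklore] -/
def FramingHomotopic (K : 𝕊 1 → W) (ν ν' : 𝕊 1 → E4) : Prop :=
  ∃ (hK : IsBoundaryKnot K) (νt : ℝ → 𝕊 1 → E4),
    IsFramingAlong (KnotIsotopyInBoundary.refl hK) ν νt ∧ νt 1 = ν'

/-- A framing is homotopic to itself (constant family). [folklore] -/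
theorem FramingHomotopic.refl {K : 𝕊 1 → W} (hK : IsBoundaryKnot K) {ν : 𝕊 1 → E4}
    (hν : IsKnotFraming K ν) : FramingHomotopic K ν ν :=
  ⟨hK, fun _ => ν, IsFramingAlong.refl hK hν, rfl⟩

/-- The first framing of a homotopic pair is a framing. [folklore] -/
theorem FramingHomotopic.isKnotFraming_left {K : 𝕊 1 → W} {ν ν' : 𝕊 1 → E4}
    (h : FramingHomotopic K ν ν') : IsKnotFraming K ν := by
  obtain ⟨hK, νt, hνt, -⟩ := h
  exact hνt.isKnotFraming_zero

/-- The second framing of a homotopic pair is a framing. [folklore] -/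
theorem FramingHomotopic.isKnotFraming_right {K : 𝕊 1 → W} {ν ν' : 𝕊 1 → E4}
    (h : FramingHomotopic K ν ν') : IsKnotFraming K ν' := by
  obtain ⟨hK, νt, hνt, rfl⟩ := h
  exact hνt.isKnotFraming_one

/-- The knot of a homotopic pair of framings is a knot in `∂W`. [folklore] -/
theorem FramingHomotopic.isBoundaryKnot {K : 𝕊 1 → W} {ν ν' : 𝕊 1 → E4}
    (h : FramingHomotopic K ν ν') : IsBoundaryKnot K :=
  h.1

/-- **Homotopy of framings is symmetric**: reverse the family, `t ↦ νt (1 - t)`. [folklore] -/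
theorem FramingHomotopic.symm {K : 𝕊 1 → W} {ν ν' : 𝕊 1 → E4} (h : FramingHomotopic K ν ν') :
    FramingHomotopic K ν' ν := by
  obtain ⟨hK, νt, hνt, h1⟩ := h
  refine ⟨hK, fun t => νt (1 - t), ⟨?_, ?_, ?_⟩, ?_⟩
  · show νt (1 - 0) = ν'
    rw [sub_zero]; exact h1
  · intro t ht
    have ht' : 1 - t ∈ Icc (0 : ℝ) 1 := ⟨by linarith [ht.2], by linarith [ht.1]⟩
    exact hνt.isKnotFraming (1 - t) ht'
  · -- joint continuity: precompose with the homeomorphism `(t, u) ↦ (1 - t, u)` of `[0,1] × S¹`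
    have hc := hνt.continuousOn
    have hφ : Continuous fun p : ℝ × (𝕊 1) => (1 - p.1, p.2) := by fun_prop
    have hmaps : MapsTo (fun p : ℝ × (𝕊 1) => (1 - p.1, p.2)) (Icc (0 : ℝ) 1 ×ˢ univ)
        (Icc (0 : ℝ) 1 ×ˢ univ) := by
      intro p hp
      simp only [mem_prod, mem_Icc, mem_univ, and_true] at hp ⊢
      constructor <;> linarith [hp.1, hp.2]
    exact hc.comp hφ.continuousOn hmaps
  · show νt (1 - 1) = ν
    rw [sub_self]; exact hνt.apply_zero

end FramingHomotopy

/-! ### The named facts -/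

/-- **Isotopy invariance of 2-handle attachment (Kirby 1989, Ch. I §1; Kosinski 1993, VI §6 with
VIII, proof of Lemma 1.2).**  Let `h`, `h'` be two finite families of attaching maps of 2-handles
on the compact (Hausdorff) 4-manifold with boundary `W`, the `h' i` with pairwise disjoint ranges.
Suppose the attaching circles of `h` are isotopic through links in `∂W` to those of `h'`
(`LinkIsotopyInBoundary`), and that along this isotopy the handle framings of `h` are carried
(`IsFramingAlong`, componentwise) to framings homotopic (`FramingHomotopic`) to the handle
framings of `h'`.  Then every `P` which is `W` with 2-handles attached along `h`
(`HandleAttachingMap.IsMultiAttachment h P`) is also `W` with 2-handles attached along `h'`: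
*"Since `Σ₂` is isotopic to `S`, `W₂` can be obtained by attaching a handle along `S` instead."*
[cite: Kosinski1993, VI §6 and VIII proof of (1.2)] -/
def HandleAttachingMap.isMultiAttachment_of_linkIsotopyInBoundary : Prop :=
  ∀ (W P : Type) [TopologicalSpace W] [T2Space W] [ChartedSpace (EuclideanHalfSpace 4) W]
    [IsManifold (𝓡∂ 4) ∞ W] [CompactSpace W] [TopologicalSpace P]
    [ChartedSpace (EuclideanHalfSpace 4) P] [IsManifold (𝓡∂ 4) ∞ P]
    (ι : Type) [Finite ι] (h h' : ι → HandleAttachingMap 3 2 W)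
    (Φ : LinkIsotopyInBoundary (fun i => (h i).attachingCircle) fun i => (h' i).attachingCircle)
    (νt : ι → ℝ → 𝕊 1 → E4),
    (∀ i, IsFramingAlong (Φ.isotopy i) (h i).attachingFraming (νt i)) →
    (∀ i, FramingHomotopic (h' i).attachingCircle (νt i 1) (h' i).attachingFraming) →
    (Pairwise fun i j => Disjoint (range (h' i).toFun) (range (h' j).toFun)) →
    HandleAttachingMap.IsMultiAttachment h (𝓡∂ 4) P →
    HandleAttachingMap.IsMultiAttachment h' (𝓡∂ 4) P

/-- **Every framed knot in the boundary of a compact orientable 4-manifold is the attaching circle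
of an attaching map with the given framing (up to homotopy), inside any prescribed neighbourhood**
(Kosinski 1993, VI §6: `h̄ : T → M` "an extension of `h` and a tubular neighborhood of `h(S)` in
`M`" — a tubular neighbourhood of the knot in `∂W` realising the framing, III (3.1) (tubular
neighbourhoods exist inside any neighbourhood and are unique) and IV §5, prolonged into `W`
along a collar).  For every open `U ⊇ K(S¹)` there is an attaching map `h̄` with range in `U`,
attaching circle `K` and handle framing homotopic to `ν` — stated from `ν` to the handle
framing, the direction consumed by ISO; the locality clause lets the attaching maps of the
components of a link be chosen with pairwise disjoint ranges.  Orientability of `W` guarantees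
that the normal bundle of the knot in `∂W` is trivial; the given nowhere-vanishing normal field
`ν` then extends to a trivialisation, unique up to homotopy. [cite: Kosinski1993, VI §6] -/
def exists_handleAttachingMap_of_isKnotFraming : Prop :=
  ∀ (W : Type) [TopologicalSpace W] [T2Space W] [ChartedSpace (EuclideanHalfSpace 4) W]
    [IsManifold (𝓡∂ 4) ∞ W] [CompactSpace W],
    IsOrientable (𝓡∂ 4) W →
    ∀ (K : 𝕊 1 → W) (ν : 𝕊 1 → E4), IsBoundaryKnot K → IsKnotFraming K ν →
    ∀ U : Set W, IsOpen U → range K ⊆ U →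
    ∃ h : HandleAttachingMap 3 2 W,
      range h.toFun ⊆ U ∧ h.attachingCircle = K ∧ FramingHomotopic K ν h.attachingFraming

/-! ### Proved special cases and conveniences -/

section API

variable {W P : Type} [TopologicalSpace W] [T2Space W] [ChartedSpace (EuclideanHalfSpace 4) W]
  [IsManifold (𝓡∂ 4) ∞ W] [CompactSpace W] [TopologicalSpace P]
  [ChartedSpace (EuclideanHalfSpace 4) P] [IsManifold (𝓡∂ 4) ∞ P]

/-- **One handle (AM §3's setting "`Z ∪ h`").**  Under ISO: if the attaching circle of `h₁` is
isotopic through knots in `∂W` to that of `h₁'`, the handle framing of `h₁` being carried to a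
framing homotopic to that of `h₁'`, then `W` with a 2-handle attached along `h₁` is `W` with a
2-handle attached along `h₁'`. [cite: Kosinski1993, VI §6 and VIII proof of (1.2)] -/
theorem HandleAttachingMap.isMultiAttachment_of_knotIsotopyInBoundary
    (hI : HandleAttachingMap.isMultiAttachment_of_linkIsotopyInBoundary)
    (h₁ h₁' : HandleAttachingMap 3 2 W)
    (Φ : KnotIsotopyInBoundary h₁.attachingCircle h₁'.attachingCircle) (νt : ℝ → 𝕊 1 → E4)
    (hν : IsFramingAlong Φ h₁.attachingFraming νt)
    (hend : FramingHomotopic h₁'.attachingCircle (νt 1) h₁'.attachingFraming)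
    (hP : HandleAttachingMap.IsMultiAttachment (fun _ : Unit => h₁) (𝓡∂ 4) P) :
    HandleAttachingMap.IsMultiAttachment (fun _ : Unit => h₁') (𝓡∂ 4) P := by
  refine hI W P Unit (fun _ => h₁) (fun _ => h₁')
    ⟨fun _ => Φ, fun t _ i j hij => absurd (Subsingleton.elim i j) hij⟩ (fun _ => νt)
    (fun _ => hν) (fun _ => hend) (fun i j hij => absurd (Subsingleton.elim i j) hij) hP

/-- Unpacking TUBE: the attaching map realising `(K, ν)` inside `U`, with its handle framing a
knot framing homotopic to `ν` in both directions. [folklore] -/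
theorem exists_handleAttachingMap_of_isKnotFraming.elim
    (hT : exists_handleAttachingMap_of_isKnotFraming) (ho : IsOrientable (𝓡∂ 4) W)
    {K : 𝕊 1 → W} {ν : 𝕊 1 → E4} (hK : IsBoundaryKnot K) (hν : IsKnotFraming K ν)
    {U : Set W} (hU : IsOpen U) (hKU : range K ⊆ U) :
    ∃ h : HandleAttachingMap 3 2 W, range h.toFun ⊆ U ∧ h.attachingCircle = K ∧
      IsKnotFraming K h.attachingFraming ∧ FramingHomotopic K ν h.attachingFraming ∧
        FramingHomotopic K h.attachingFraming ν := by
  obtain ⟨h, hU', hK', hF⟩ := hT W ho K ν hK hν U hU hKU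
  exact ⟨h, hU', hK', hF.isKnotFraming_right, hF, hF.symm⟩

/-- TUBE with no locality requested (`U = univ`). [folklore] -/
theorem exists_handleAttachingMap_of_isKnotFraming.elim_univ
    (hT : exists_handleAttachingMap_of_isKnotFraming) (ho : IsOrientable (𝓡∂ 4) W)
    {K : 𝕊 1 → W} {ν : 𝕊 1 → E4} (hK : IsBoundaryKnot K) (hν : IsKnotFraming K ν) :
    ∃ h : HandleAttachingMap 3 2 W, h.attachingCircle = K ∧ FramingHomotopic K ν h.attachingFraming := by
  obtain ⟨h, -, hK', hF⟩ := hT W ho K ν hK hν univ isOpen_univ (subset_univ _)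
  exact ⟨h, hK', hF⟩

end API

end Literature.Geometry.Symplectic

end
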